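import Summits.Ventures.CertifiedManyBodySolver.Rows.HalfFilledTL
import Summits.Ventures.CertifiedManyBodySolver.HubbardAlg.GSStabilityRowsSzZero
import Literature.MathematicalPhysics.QuantumLattice.InfVolFermionStateTorusLimitKKT
import HarnessLib

/-!
# M2 rows: the state-optimality (`kkt`) block over TLGS(U) — every number-conserving generator family

HONEST FRAMING (page 1): first certified bounds; not a superconductivity verdict; every number certified or
labelled float.  This file has NO number and NO certificate: it is row SOUNDNESS only.

WHAT THIS FILE IS (speedrun cell `sr-mbsolver`, seat m2-3 gen 55; answer to m2-2 RESULT P7, unit INBOX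
2026-08-22T11:09Z, `HOME/sr-mbsolver-m2-2/gskit/KIND-KKT-BOX.md` §1 "the TL licence would be a new Lean fact").
The licence is NOT new for sector ground states: the tree already proves the PSD-weighted state-optimality
block `0 ≤ Re ω(kktForm H_{Λ⁺} G B̃)` for torus limits of `(N, S^z = M)`-SECTOR ground states and generators
conserving the local `N̂` AND `S^z` (`InfVolFermionState.IsTorusLimitOf.re_expect_kktForm_nonneg`), and local
stability without the `S^z` hypothesis for `(2m, S^z = 0)`-sector limits
(`HubbardAlg.GSStabilityRowsSzZero.localStability_of_szZero`).  The M2 class of record, however, is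
`M2.IsTLGS U ω` (`Rows/HalfFilledTL` §1): torus limits of `L²`-particle ground states of
`hamiltonian (fermionTorusGraph 2 L) 1 U` in the sense of `HubbardWave0.IsGroundState` — ground states on the
WHOLE `N`-particle space, no `S^z` datum, no sign of `U`, `L` even.  For that datum the ground-state inequality
`⟨φ, B⋆(HB − BH)φ⟩ = ⟨Bφ, (H − E₀(N))Bφ⟩ ≥ 0` holds for EVERY `B` commuting with the particle number (any
`ΔS^z`, any spin structure), by `star_dotProduct_conjTranspose_mul_commutator_mulVec_nonneg` on the invariant
subspace `nParticleSubmodule N`; averaging over translations (`isGroundState_fockTranslate_mulVec`) and passing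
to the torus limit exactly as in `InfVolFermionStateTorusLimitLocalStability`, then weak duality for the
PSD-weighted element (`StateRelaxation.re_map_kktForm_nonneg`), gives:

* §1 `star_dotProduct_commutator_nonneg_of_isGroundState` — finite volume, any graph, any `t, U`, any `N`;
* §2 `expect_fermionEmbed_stability_nonneg_of_isGroundState`, `torusAvgExpectAt_stability_nonneg_of_isGroundState`,
  `localStability_of_isGroundState` — torus, translation average, torus limit (`ω(Ã⋆[H_{thicken Λ 1}, Ã]) ≥ 0`
  for every `A ∈ 𝔄_Λ` with `Commute A totalNumber`; any `d, t, U`, any particle numbers `N_j`);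
* §3 `re_expect_kktForm_nonneg_of_isGroundState` (+ `ComplexOrder` form) — the `kkt` block for every finite
  generator family `B_b ∈ 𝔄_Λ` conserving the local `N̂` and every `G ⪰ 0`;
* §4 the TLGS(U) corollaries `IsTLGS.localStability`, `IsTLGS.re_expect_kktForm_nonneg`,
  `IsTLGS.expect_kktForm_nonneg`, `IsTLGS.re_expect_kktForm_vecMulVec_nonneg` (rank-one `G = c̄ cᵀ`, the shape of
  one certificate line), `IsTLGS.re_expect_sub_kktForm_le` (slack form: the block may be moved into the
  objective and dropped) — NO `U > 0`, NO Lieb uniqueness, NO evenness used;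
Theorems only (no `def`): the universally quantified `IsTLGS.re_expect_kktForm_nonneg` IS the declared row
family of kind `kkt` (pattern of `Rows/HalfFilledTLDeclaredRows` §1) — a declared-row node file may package it as
a predicate when a referee-signed certificate with `kkt` rows exists; TLGS(U) is inhabited for `U > 0`
(`IsTLGS.nonempty`), so the rows are not vacuously discharged.

READING RULE for certificates (engine block kind `kkt`, m2-2 `gskit/main_gs_v2.py`; generators = words with
`ΔN = 0`, e.g. `{n_{0σ}, c⋆_{0σ}c_{δσ'}, c⋆_{δσ'}c_{0σ}}`; "open" and "strict" formulations differ only in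
which moments the relaxation carries, not in the row): the block's dual PSD multiplier `G ⪰ 0` contributes the
summand `kktForm H_{thicken Λ 1} G B̃` whose expectation is `≥ 0` in every `ω ∈ TLGS(U)` by §4 — for the e₀
floor (m2-2/m2-5), the `C_nn` / docc windows (m2-3/m2-4) and any other TL row over `IsTLGS` alike.
NOT covered (false for canonical limits in general): generators changing the particle number (`[N̂, B] ≠ 0`).

References: [cite: BratteliRobinsonII1997, Prop. 5.3.19 + Prop. 5.3.25] (ground states: `-i ω(A⋆δ(A)) ≥ 0`);
[cite: AraujoEtAl2023, §3.2 Prop. 11] (state optimality, PSD-weighted form); [cite: KullEtAl2024, §II.B]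
(ground-state positivity blocks of lattice relaxations).  Cell record: `HOME/sr-mbsolver-m2-3/lean/HalfFilledTLKKT.lean`.
-/

noncomputable section

namespace Summit.Ventures.CertifiedManyBodySolver

open Literature.MathematicalPhysics.QuantumLattice
open Literature.MathematicalPhysics.QuantumManyBody.StateRelaxation
open Matrix HubbardWave0 Literature.Probability.LatticeModels ThermodynamicLimit Filter Topology
open Summit.Ventures.CertifiedManyBodySolver.HubbardAlg.GSStabilityRowsSzZero (mulVec_mem_nParticleSubmodule_of_commute)
open scoped ComplexOrder BigOperators

namespace M2

/-! ## §1 Finite volume: the ground-state inequality for an `N`-particle ground state -/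

section FiniteVolume

variable {Λ : Type*} [LinearOrder Λ] [Fintype Λ] (G : SimpleGraph Λ) [DecidableRel G.Adj]

/-- **The ground-state inequality for every number-conserving perturbation** (finite volume): for an
`N`-particle ground state `φ` of the Hubbard Hamiltonian (`HubbardWave0.IsGroundState`: eigenvector with the
`N`-particle ground-state energy) and every `B` commuting with the particle number,
`⟨φ, B⋆(HB − BH)φ⟩ = ⟨Bφ, (H − E₀(N))Bφ⟩ ≥ 0` (real and nonnegative).  No `S^z` hypothesis on `B`, no sign of
`U`. [cite: BratteliRobinsonII1997, Prop. 5.3.19] -/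
theorem star_dotProduct_commutator_nonneg_of_isGroundState (t U : ℝ) {N : ℕ} {φ : Fock (Orb Λ)}
    (hφ : IsGroundState (hamiltonian G t U) N φ)
    {B : Matrix (Finset (Orb Λ)) (Finset (Orb Λ)) ℂ} (hB : Commute B totalNumber) :
    0 ≤ star φ ⬝ᵥ ((Bᴴ * (hamiltonian G t U * B - B * hamiltonian G t U)) *ᵥ φ) := by
  obtain ⟨hN, -, hE⟩ := hφ
  rw [groundEnergy_eq_minEnergyOn _ N (nParticleSubmodule N) (mem_nParticleSubmodule_iff N)] at hE
  exact star_dotProduct_conjTranspose_mul_commutator_mulVec_nonneg (LiebThm1.hamiltonian_isHermitian G t U)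
    (nParticleSubmodule N) (fun v hv => mulVec_mem_nParticleSubmodule_of_commute hB hv)
    ((mem_nParticleSubmodule_iff N φ).2 hN) hE

end FiniteVolume

/-! ## §2 Torus: local stability observable, translation average, torus limit -/

section Torus

variable {d : ℕ} (L : ℕ) [NeZero L] (t U : ℝ)

/-- **Finite volume (torus).** In an `N`-particle ground state `φ` of `hubbardTorus d L t U`, for every region
`Λ` small in the torus and every local `A ∈ 𝔄_Λ` conserving the local particle number:
`⟨φ, Γ(Ã⋆ [H_{thicken Λ 1}, Ã]) φ⟩ ≥ 0`.  The tree's `expect_fermionEmbed_localStability_nonneg` with the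
invariant subspace `szSector N M` replaced by the `N`-particle subspace. [cite: BratteliRobinsonII1997, Prop. 5.3.19] -/
theorem expect_fermionEmbed_stability_nonneg_of_isGroundState {Λ : Finset (Site d)}
    (hInj : Set.InjOn (Torus.proj (d := d) L) ↑(thicken (thicken Λ 1) 1)) {N : ℕ}
    {φ : Fock (Orb (FermionTorus d L))} (hφ : IsGroundState (hubbardTorus d L t U) N φ)
    {A : FermionOp Λ} (hAN : Commute A totalNumber) :
    0 ≤ expect (fermionEmbed (PolySite.toTorusEmb L (hInj.mono (by exact_mod_cast subset_thicken (thicken Λ 1) 1)))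
        ((fermionEmbed (PolySite.incl (subset_thicken Λ 1)) A)ᴴ *
          ((hubbardFermionInteraction d t U).localHamiltonian (thicken Λ 1) *
              fermionEmbed (PolySite.incl (subset_thicken Λ 1)) A -
            fermionEmbed (PolySite.incl (subset_thicken Λ 1)) A *
              (hubbardFermionInteraction d t U).localHamiltonian (thicken Λ 1)))) φ := by
  have hclosed : ∀ x ∈ Λ, ∀ i : Fin d, x + unitVec i ∈ thicken Λ 1 ∧ x - unitVec i ∈ thicken Λ 1 :=
    fun x hx i => ⟨add_unitVec_mem_thicken_one hx i, sub_unitVec_mem_thicken_one hx i⟩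
  have hΛ : Set.InjOn (Torus.proj (d := d) L) ↑Λ :=
    hInj.mono (by exact_mod_cast (subset_thicken Λ 1).trans (subset_thicken (thicken Λ 1) 1))
  rw [Literature.MathematicalPhysics.QuantumLattice.expect, fermionEmbed_mul, fermionEmbed_conjTranspose,
    ← hubbardTorus_commutator_fermionEmbed L t U (subset_thicken Λ 1) hclosed hInj A]
  have hB : fermionEmbed (PolySite.toTorusEmb L (hInj.mono (by exact_mod_cast subset_thicken (thicken Λ 1) 1)))
      (fermionEmbed (PolySite.incl (subset_thicken Λ 1)) A) = fermionEmbed (PolySite.toTorusEmb L hΛ) A := by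
    rw [fermionEmbed_fermionEmbed]
    exact congrFun (congrArg DFunLike.coe (fermionEmbed_congr fun p => rfl)) A
  rw [hB]
  exact star_dotProduct_commutator_nonneg_of_isGroundState (fermionTorusGraph d L) t U hφ
    (commute_fermionEmbed_toTorusEmb_totalNumber L hΛ hAN)

/-- **Finite volume, translation average** (every translate of an `N`-particle ground state of the
translation-invariant `hubbardTorus` is one, `isGroundState_fockTranslate_mulVec`). [cite: BratteliRobinsonII1997, Prop. 5.3.19] -/
theorem torusAvgExpectAt_stability_nonneg_of_isGroundState {Λ : Finset (Site d)}
    (hInj : Set.InjOn (Torus.proj (d := d) L) ↑(thicken (thicken Λ 1) 1)) {N : ℕ}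
    {ψ : Fock (Orb (FermionTorus d L))} (hψ : IsGroundState (hubbardTorus d L t U) N ψ)
    {A : FermionOp Λ} (hAN : Commute A totalNumber) :
    0 ≤ torusAvgExpectAt L (thicken Λ 1)
        ((fermionEmbed (PolySite.incl (subset_thicken Λ 1)) A)ᴴ *
          ((hubbardFermionInteraction d t U).localHamiltonian (thicken Λ 1) *
              fermionEmbed (PolySite.incl (subset_thicken Λ 1)) A -
            fermionEmbed (PolySite.incl (subset_thicken Λ 1)) A *
              (hubbardFermionInteraction d t U).localHamiltonian (thicken Λ 1))) ψ := by
  have h₁ : Set.InjOn (Torus.proj (d := d) L) ↑(thicken Λ 1) :=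
    hInj.mono (by exact_mod_cast subset_thicken (thicken Λ 1) 1)
  rw [torusAvgExpectAt_of_injOn L h₁]
  have hsum : (0 : ℂ) ≤ ∑ v : TorusSite d L, expect (fermionEmbed (PolySite.toTorusEmb L h₁)
      ((fermionEmbed (PolySite.incl (subset_thicken Λ 1)) A)ᴴ *
        ((hubbardFermionInteraction d t U).localHamiltonian (thicken Λ 1) *
            fermionEmbed (PolySite.incl (subset_thicken Λ 1)) A -
          fermionEmbed (PolySite.incl (subset_thicken Λ 1)) A *
            (hubbardFermionInteraction d t U).localHamiltonian (thicken Λ 1))))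
      ((fockTranslate v).val *ᵥ ψ) :=
    Finset.sum_nonneg fun v _ => expect_fermionEmbed_stability_nonneg_of_isGroundState L t U hInj
      (isGroundState_fockTranslate_mulVec t U v hψ) hAN
  obtain ⟨hre, him⟩ := Complex.nonneg_iff.1 hsum
  rw [show ((Fintype.card (TorusSite d L) : ℂ))⁻¹ = (((Fintype.card (TorusSite d L) : ℝ)⁻¹ : ℝ) : ℂ) by
    push_cast; rfl, Complex.nonneg_iff, Complex.re_ofReal_mul, Complex.im_ofReal_mul, ← him, mul_zero]
  exact ⟨mul_nonneg (inv_nonneg.2 (Nat.cast_nonneg _)) hre, rfl⟩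

variable {L}

/-- **Local stability of torus-limit `N`-particle ground states under EVERY gauge-invariant local
perturbation.**  Let `ω` be a torus limit of the translation averages of `N_j`-particle ground states
`ψ_{Ls j}` of `hubbardTorus d (Ls j) t U` (`HubbardWave0.IsGroundState`), `Ls → ∞`.  Then for every region `Λ`
and every `A ∈ 𝔄_Λ` conserving the local particle number, `ω(Ã⋆ [H_{thicken Λ 1}, Ã]) ≥ 0`.
[cite: BratteliRobinsonII1997, Prop. 5.3.25] -/
theorem localStability_of_isGroundState {ω : InfVolFermionState d}
    {ψ : ∀ L, Fock (Orb (FermionTorus d L))} {Ls : ℕ → ℕ} (h : ω.IsTorusLimitOf ψ Ls)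
    (hLs : Tendsto Ls atTop atTop) {N : ℕ → ℕ}
    (hgs : ∀ j, IsGroundState (hubbardTorus d (Ls j) t U) (N j) (ψ (Ls j)))
    {Λ : Finset (Site d)} {A : FermionOp Λ} (hAN : Commute A totalNumber) :
    0 ≤ ω.expect (thicken Λ 1)
        ((fermionEmbed (PolySite.incl (subset_thicken Λ 1)) A)ᴴ *
          ((hubbardFermionInteraction d t U).localHamiltonian (thicken Λ 1) *
              fermionEmbed (PolySite.incl (subset_thicken Λ 1)) A -
            fermionEmbed (PolySite.incl (subset_thicken Λ 1)) A *
              (hubbardFermionInteraction d t U).localHamiltonian (thicken Λ 1))) := by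
  refine ge_of_tendsto (h (thicken Λ 1) _) ?_
  filter_upwards [eventually_injOn_proj_of_tendsto (thicken (thicken Λ 1) 1) hLs, hLs.eventually_ge_atTop 1]
    with j hInj hj
  haveI : NeZero (Ls j) := ⟨by omega⟩
  rw [torusAvgExpect_eq]
  exact torusAvgExpectAt_stability_nonneg_of_isGroundState (Ls j) t U hInj (hgs j) hAN

/-! ## §3 The PSD-weighted state-optimality (`kkt`) block -/

/-- **The `kkt` block is nonnegative in torus-limit `N`-particle ground states, for every generator family
conserving the local particle number.**  `ω` as in `localStability_of_isGroundState`; `B_b ∈ 𝔄_Λ` (finitely many)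
with `Commute (B b) totalNumber` (no `S^z` hypothesis); `G ⪰ 0`.  Then
`0 ≤ Re ω(kktForm H_{thicken Λ 1} G B̃)`, `B̃_b = B_b` embedded in `𝔄_{thicken Λ 1}` (weak duality
`re_map_kktForm_nonneg` + §2). [cite: BratteliRobinsonII1997, Prop. 5.3.25] [cite: AraujoEtAl2023, §3.2 Prop. 11] -/
theorem re_expect_kktForm_nonneg_of_isGroundState {ω : InfVolFermionState d}
    {ψ : ∀ L, Fock (Orb (FermionTorus d L))} {Ls : ℕ → ℕ} (h : ω.IsTorusLimitOf ψ Ls)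
    (hLs : Tendsto Ls atTop atTop) {N : ℕ → ℕ}
    (hgs : ∀ j, IsGroundState (hubbardTorus d (Ls j) t U) (N j) (ψ (Ls j)))
    {Λ : Finset (Site d)} {m : Type*} [Fintype m] [DecidableEq m] {G : Matrix m m ℂ} (hG : G.PosSemidef)
    (B : m → FermionOp Λ) (hBN : ∀ b, Commute (B b) totalNumber) :
    0 ≤ (ω.expect (thicken Λ 1)
      (kktForm ((hubbardFermionInteraction d t U).localHamiltonian (thicken Λ 1)) G
        (fun b => fermionEmbed (PolySite.incl (subset_thicken Λ 1)) (B b)))).re := by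
  refine re_map_kktForm_nonneg (ω.expect (thicken Λ 1)) _ hG _ fun w => ?_
  have hsum : ∑ b, w b • fermionEmbed (PolySite.incl (subset_thicken Λ 1)) (B b) =
      fermionEmbed (PolySite.incl (subset_thicken Λ 1)) (∑ b, w b • B b) := by
    rw [map_sum]
    exact Finset.sum_congr rfl fun b _ => (map_smul _ _ _).symm
  rw [hsum, Matrix.star_eq_conjTranspose]
  exact (Complex.nonneg_iff.1
    (localStability_of_isGroundState t U h hLs hgs (commute_sum_smul_of_commute B _ hBN w))).1

/-- The same in `ComplexOrder` (`ω(kktForm …)` is real and nonnegative).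
[cite: BratteliRobinsonII1997, Prop. 5.3.25] [cite: AraujoEtAl2023, §3.2 Prop. 11] -/
theorem expect_kktForm_nonneg_of_isGroundState {ω : InfVolFermionState d}
    {ψ : ∀ L, Fock (Orb (FermionTorus d L))} {Ls : ℕ → ℕ} (h : ω.IsTorusLimitOf ψ Ls)
    (hLs : Tendsto Ls atTop atTop) {N : ℕ → ℕ}
    (hgs : ∀ j, IsGroundState (hubbardTorus d (Ls j) t U) (N j) (ψ (Ls j)))
    {Λ : Finset (Site d)} {m : Type*} [Fintype m] [DecidableEq m] {G : Matrix m m ℂ} (hG : G.PosSemidef)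
    (B : m → FermionOp Λ) (hBN : ∀ b, Commute (B b) totalNumber) :
    0 ≤ ω.expect (thicken Λ 1)
      (kktForm ((hubbardFermionInteraction d t U).localHamiltonian (thicken Λ 1)) G
        (fun b => fermionEmbed (PolySite.incl (subset_thicken Λ 1)) (B b))) := by
  refine map_kktForm_nonneg (ω.expect (thicken Λ 1)) _ hG _ fun w => ?_
  have hsum : ∑ b, w b • fermionEmbed (PolySite.incl (subset_thicken Λ 1)) (B b) =
      fermionEmbed (PolySite.incl (subset_thicken Λ 1)) (∑ b, w b • B b) := by
    rw [map_sum]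
    exact Finset.sum_congr rfl fun b _ => (map_smul _ _ _).symm
  rw [hsum, Matrix.star_eq_conjTranspose]
  exact localStability_of_isGroundState t U h hLs hgs (commute_sum_smul_of_commute B _ hBN w)

end Torus

/-! ## §4 TLGS(U): the M2 class of record (`d = 2`, `t = 1`, `N = L²`, `L` even) -/

/-- **Local stability over TLGS(U)**: for every `ω ∈ TLGS(U)` (ANY real `U`), every region `Λ` and every
`A ∈ 𝔄_Λ` conserving the local particle number, `ω(Ã⋆ [H_{thicken Λ 1}, Ã]) ≥ 0`. [cite: BratteliRobinsonII1997, Prop. 5.3.25] -/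
theorem IsTLGS.localStability {U : ℝ} {ω : InfVolFermionState 2} (h : IsTLGS U ω)
    {Λ : Finset (Site 2)} {A : FermionOp Λ} (hAN : Commute A totalNumber) :
    0 ≤ ω.expect (thicken Λ 1)
        ((fermionEmbed (PolySite.incl (subset_thicken Λ 1)) A)ᴴ *
          ((hubbardFermionInteraction 2 1 U).localHamiltonian (thicken Λ 1) *
              fermionEmbed (PolySite.incl (subset_thicken Λ 1)) A -
            fermionEmbed (PolySite.incl (subset_thicken Λ 1)) A *
              (hubbardFermionInteraction 2 1 U).localHamiltonian (thicken Λ 1))) := by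
  obtain ⟨Ls, ψ, hLs, -, hψ, -, hω⟩ := h
  exact localStability_of_isGroundState 1 U hω hLs hψ hAN

/-- **The `kkt` block over TLGS(U)** (engine block kind `kkt`; every finite generator family with `ΔN = 0`, every
`G ⪰ 0`, ANY real `U`): `0 ≤ Re ω(kktForm H_{thicken Λ 1} G B̃)` for every `ω ∈ TLGS(U)` — the `kkt` block of a
`setting: TL` certificate over the M2 class is a valid ground-state block.
[cite: BratteliRobinsonII1997, Prop. 5.3.25] [cite: AraujoEtAl2023, §3.2 Prop. 11] -/
theorem IsTLGS.re_expect_kktForm_nonneg {U : ℝ} {ω : InfVolFermionState 2} (h : IsTLGS U ω)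
    {Λ : Finset (Site 2)} {m : Type*} [Fintype m] [DecidableEq m] {G : Matrix m m ℂ} (hG : G.PosSemidef)
    (B : m → FermionOp Λ) (hBN : ∀ b, Commute (B b) totalNumber) :
    0 ≤ (ω.expect (thicken Λ 1)
      (kktForm ((hubbardFermionInteraction 2 1 U).localHamiltonian (thicken Λ 1)) G
        (fun b => fermionEmbed (PolySite.incl (subset_thicken Λ 1)) (B b)))).re := by
  obtain ⟨Ls, ψ, hLs, -, hψ, -, hω⟩ := h
  exact re_expect_kktForm_nonneg_of_isGroundState 1 U hω hLs hψ hG B hBN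

/-- The same in `ComplexOrder`. [cite: BratteliRobinsonII1997, Prop. 5.3.25] [cite: AraujoEtAl2023, §3.2 Prop. 11] -/
theorem IsTLGS.expect_kktForm_nonneg {U : ℝ} {ω : InfVolFermionState 2} (h : IsTLGS U ω)
    {Λ : Finset (Site 2)} {m : Type*} [Fintype m] [DecidableEq m] {G : Matrix m m ℂ} (hG : G.PosSemidef)
    (B : m → FermionOp Λ) (hBN : ∀ b, Commute (B b) totalNumber) :
    0 ≤ ω.expect (thicken Λ 1)
      (kktForm ((hubbardFermionInteraction 2 1 U).localHamiltonian (thicken Λ 1)) G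
        (fun b => fermionEmbed (PolySite.incl (subset_thicken Λ 1)) (B b))) := by
  obtain ⟨Ls, ψ, hLs, -, hψ, -, hω⟩ := h
  exact expect_kktForm_nonneg_of_isGroundState 1 U hω hLs hψ hG B hBN

/-- **Rank-one multiplier** (`G = c̄ cᵀ ⪰ 0`), the shape of one certificate line / one eigen-piece of a PSD
block multiplier. [cite: AraujoEtAl2023, §3.2 Prop. 11] -/
theorem IsTLGS.re_expect_kktForm_vecMulVec_nonneg {U : ℝ} {ω : InfVolFermionState 2} (h : IsTLGS U ω)
    {Λ : Finset (Site 2)} {m : Type*} [Fintype m] [DecidableEq m] (c : m → ℂ)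
    (B : m → FermionOp Λ) (hBN : ∀ b, Commute (B b) totalNumber) :
    0 ≤ (ω.expect (thicken Λ 1)
      (kktForm ((hubbardFermionInteraction 2 1 U).localHamiltonian (thicken Λ 1)) (vecMulVec (star c) c)
        (fun b => fermionEmbed (PolySite.incl (subset_thicken Λ 1)) (B b)))).re :=
  h.re_expect_kktForm_nonneg (Matrix.posSemidef_vecMulVec_star_self c) B hBN

/-- **Slack form for certificates**: for a `kkt` summand `K = kktForm H_{thicken Λ 1} G B̃` with `G ⪰ 0` and
number-conserving generators, `Re ω(X − K) ≤ Re ω(X)` for every `ω ∈ TLGS(U)` (the block may be moved into the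
objective and dropped). [cite: AraujoEtAl2023, §3.2 Prop. 11] -/
theorem IsTLGS.re_expect_sub_kktForm_le {U : ℝ} {ω : InfVolFermionState 2} (h : IsTLGS U ω)
    {Λ : Finset (Site 2)} {m : Type*} [Fintype m] [DecidableEq m] {G : Matrix m m ℂ} (hG : G.PosSemidef)
    (B : m → FermionOp Λ) (hBN : ∀ b, Commute (B b) totalNumber) (X : FermionOp (thicken Λ 1)) :
    (ω.expect (thicken Λ 1) (X - kktForm ((hubbardFermionInteraction 2 1 U).localHamiltonian (thicken Λ 1)) G
        (fun b => fermionEmbed (PolySite.incl (subset_thicken Λ 1)) (B b)))).re ≤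
      (ω.expect (thicken Λ 1) X).re := by
  rw [map_sub, Complex.sub_re]
  linarith [h.re_expect_kktForm_nonneg hG B hBN]

end M2

end Summit.Ventures.CertifiedManyBodySolver

end
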